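import Literature.InformationTheory.QuantumCodes.TwistedToricErasureHalfPolynomial
import Literature.InformationTheory.QuantumCodes.LossThresholdOneArm
import HarnessLib

/-!
# Exponential decay below the loss threshold for twisted / rotated toric codes

Topic `Literature/InformationTheory/QuantumCodes` (venture QEC, LADDER-QEC rung Q5; qec-type-03). All PROVED, no named fact, kernel
axioms. The POINTWISE form of the percolation bound behind `TwistedToric.twistedToric_lossThreshold_half`
(`TwistedToricErasureHalf.lean`), and its consequence: below `1/2` the loss-uncorrectability probability of the rotated
families decays exponentially in the index (`DecaysExponentially`, Dennis et al. §5.3), via the generic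
`decaysExponentially_of_abs_le_poly_mul_exp` (`LossThresholdOneArm.lean`).

* `uncorrectableProb_code_le_card_mul` — for every twisted toric code and every `r` with `4r + 1 ≤ sys₁`:
  `P_p[loss uncorrectable] ≤ |G| · P_p(0 ↔ ∂B(r))` (union bound over the centres of the periodic lifts; the lift has the
  exact `ℤ²` bond-percolation law on box events, `eventProb_lift_eq_of_injOn`);
* `twistedToric_loss_decaysExponentially_of_linear` — `|G_i| ≤ A (i+1)^m` and `sys₁(Λ_i) ≥ i + 1` ⇒ for `0 ≤ y < 1/2`,
  `P_y[uncorrectable_i] ≤ C r^i` with `r < 1` (`DecaysExponentially`);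
* `rotatedToric_loss_decaysExponentially` — the rotated codes `[[d²+1, 2, d]]` (`d = 2t+1`, index `t`);
* `dilatedToric_loss_decaysExponentially` — the dilated family `[[2n²c_t, 2, n(2t+1)]]` at fixed `t` (index `n`).

References: [StaceBarrettDoherty2009] PRL 102 (2009) 200501, p. 2–3; [KestenCMP1980] Comm. Math. Phys. 74 (1980) 41–59,
Thm. 2 (1.7); [DennisEtAl2002] J. Math. Phys. 43 (2002) 4452, §5.3; [KovalevPryadko2013Hyperbicycle] PRA 88 (2013) 012311,
§III.B Ex. 2, §IV Ex. 7.
-/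

namespace Literature.InformationTheory.QuantumCodes

namespace TwistedToric

open Finset Matrix Filter Topology
open Literature.Probability.LatticeModels (Site box zdGraph)
open Literature.Probability.Percolation (BondConfig siteToBoundary bondPercolation Kesten1980_expDecay)

variable {G : Type*} [AddCommGroup G] [DecidableEq G] [Fintype G]

open Classical in
/-- **Pointwise percolation bound**: for a twisted toric code with `4r + 1 ≤ sys₁(Λ)` and every loss rate `p`,
`P_p[loss pattern uncorrectable] ≤ |G| · P_p(0 ↔ ∂B(r))` — a bad pattern contains a homologically non-trivial closed walk,
whose periodic lift at some centre `v` is a one-arm event of radius `r` (`exists_twistedLift_mem_siteToBoundary`), and each lift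
has the `ℤ²` bond-percolation law on events determined in `B(r)` (`eventProb_lift_eq_of_injOn`, `injOn_linkAt`).
[cite: StaceBarrettDoherty2009, p. 2–3 (loss recovery fails iff a lost homologically non-trivial cycle; percolation)] -/
theorem uncorrectableProb_code_le_card_mul (g₁ g₂ : G) {r : ℕ} (hr : 4 * r + 1 ≤ systole g₁ g₂) (p : unitInterval) :
    ErasureDecoder.uncorrectableProb {z : G ⊕ G → ZMod 2 | (code g₁ g₂).HX *ᵥ z = 0}
        ((code g₁ g₂).rowSpZ : Set (G ⊕ G → ZMod 2)) p ≤
      (Fintype.card G : ℝ) * (bondPercolation (zdGraph 2) p).real (siteToBoundary 2 r) := by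
  have hp0 : 0 ≤ (p : ℝ) := p.2.1
  have hp1 : (p : ℝ) ≤ 1 := p.2.2
  set E : G → Finset (G ⊕ G) → Prop := fun v Er => twistedLift g₁ g₂ v Er ∈ siteToBoundary 2 r with hE
  have h1 : ErasureDecoder.uncorrectableProb {z : G ⊕ G → ZMod 2 | (code g₁ g₂).HX *ᵥ z = 0}
      ((code g₁ g₂).rowSpZ : Set (G ⊕ G → ZMod 2)) p ≤
      eventProb (fun Er : Finset (G ⊕ G) => ∃ v ∈ (univ : Finset G), E v Er) p := by
    unfold ErasureDecoder.uncorrectableProb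
    refine eventProb_mono (fun Er hEr => ?_) hp0 hp1
    obtain ⟨v, hv⟩ := exists_twistedLift_mem_siteToBoundary g₁ g₂ hr hEr
    exact ⟨v, Finset.mem_univ _, hv⟩
  have h2 : eventProb (fun Er : Finset (G ⊕ G) => ∃ v ∈ (univ : Finset G), E v Er) p ≤
      ∑ v ∈ (univ : Finset G), eventProb (E v) p := by
    convert eventProb_exists_le_sum (univ : Finset G) E hp0 hp1
  have h3 : ∀ v, eventProb (E v) p = (bondPercolation (zdGraph 2) p).real (siteToBoundary 2 r) := fun v =>
    eventProb_lift_eq_of_injOn (twistedLift g₁ g₂ v) (linkAt g₁ g₂ v) (twistedLift_subset_edgeSet g₁ g₂ v)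
      (fun Er d _ => mem_twistedLift_iff g₁ g₂ v Er d) (injOn_linkAt g₁ g₂ v hr)
      (Literature.Probability.Percolation.DCT16.determinedBy_siteToBoundary 2 r) p
  calc _ ≤ ∑ v ∈ (univ : Finset G), eventProb (E v) p := h1.trans h2
    _ = (Fintype.card G : ℝ) * (bondPercolation (zdGraph 2) p).real (siteToBoundary 2 r) := by
        rw [Finset.sum_congr rfl fun v _ => h3 v, Finset.sum_const, nsmul_eq_mul, Finset.card_univ]

open Classical in
/-- **Exponential decay below `1/2` for polynomial volume and linear systole**: if `|G_i| ≤ A (i+1)^m` and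
`sys₁(Λ_i) ≥ i + 1`, then for every loss rate `0 ≤ y < 1/2` the loss-uncorrectability probability of `code (g₁ i) (g₂ i)`
is `≤ C r^i` with `r < 1` (`|G_i| · P_y(0 ↔ ∂B(⌊i/4⌋)) ≤ A e^{c} (i+1)^m e^{-(c/4) i}` by Kesten's decay, then
`decaysExponentially_of_abs_le_poly_mul_exp`). [cite: KestenCMP1980, Thm. 2 (1.7)] [cite: DennisEtAl2002, §5.3]
[cite: StaceBarrettDoherty2009, p. 2–3] -/
theorem twistedToric_loss_decaysExponentially_of_linear {Gs : ℕ → Type*} [∀ i, AddCommGroup (Gs i)]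
    [∀ i, DecidableEq (Gs i)] [∀ i, Fintype (Gs i)] (g₁ g₂ : ∀ i, Gs i) {A : ℝ} {m : ℕ}
    (hcard : ∀ i, (Fintype.card (Gs i) : ℝ) ≤ A * ((i : ℝ) + 1) ^ m) (hsys : ∀ i, i + 1 ≤ systole (g₁ i) (g₂ i))
    {y : ℝ} (hy0 : 0 ≤ y) (hy : y < 1 / 2) :
    DecaysExponentially (fun i y => ErasureDecoder.uncorrectableProb
      {z : Gs i ⊕ Gs i → ZMod 2 | (code (g₁ i) (g₂ i)).HX *ᵥ z = 0}
      ((code (g₁ i) (g₂ i)).rowSpZ : Set (Gs i ⊕ Gs i → ZMod 2)) y) y := by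
  have hy1 : y ≤ 1 := by linarith
  set p : unitInterval := ⟨y, hy0, hy1⟩ with hp
  obtain ⟨c, hc, hdec⟩ := Kesten1980_expDecay p (by simpa [hp] using hy)
  have hA : 0 ≤ A := by
    have h := hcard 0
    have h0 : (0 : ℝ) ≤ (Fintype.card (Gs 0) : ℝ) := Nat.cast_nonneg _
    simp at h
    linarith
  refine decaysExponentially_of_abs_le_poly_mul_exp (B := A * Real.exp c) (m := m) (by positivity : 0 < c / 4)
    fun i => ?_
  have hnn : 0 ≤ ErasureDecoder.uncorrectableProb {z : Gs i ⊕ Gs i → ZMod 2 | (code (g₁ i) (g₂ i)).HX *ᵥ z = 0}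
      ((code (g₁ i) (g₂ i)).rowSpZ : Set (Gs i ⊕ Gs i → ZMod 2)) y :=
    ErasureDecoder.uncorrectableProb_nonneg _ _ hy0 hy1
  rw [abs_of_nonneg hnn]
  have hr : 4 * (i / 4) + 1 ≤ systole (g₁ i) (g₂ i) := le_trans (by omega) (hsys i)
  refine (uncorrectableProb_code_le_card_mul (g₁ i) (g₂ i) hr p).trans ?_
  have hfloor : ((i : ℝ) - 3) / 4 ≤ ((i / 4 : ℕ) : ℝ) := by
    have h1 : i ≤ 4 * (i / 4) + 3 := by omega
    have h2 : (i : ℝ) ≤ 4 * ((i / 4 : ℕ) : ℝ) + 3 := by exact_mod_cast h1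
    linarith
  have hexp : (bondPercolation (zdGraph 2) p).real (siteToBoundary 2 (i / 4)) ≤
      Real.exp c * Real.exp (-(c / 4) * (i : ℝ)) := by
    refine (hdec _).trans ?_
    rw [← Real.exp_add]
    apply Real.exp_le_exp.2
    nlinarith
  calc (Fintype.card (Gs i) : ℝ) * (bondPercolation (zdGraph 2) p).real (siteToBoundary 2 (i / 4))
      ≤ (A * ((i : ℝ) + 1) ^ m) * (Real.exp c * Real.exp (-(c / 4) * (i : ℝ))) :=
        mul_le_mul (hcard i) hexp (by positivity) (by positivity)
    _ = A * Real.exp c * ((i : ℝ) + 1) ^ m * Real.exp (-(c / 4) * (i : ℝ)) := by ring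

open Classical in
/-- **Exponential decay for the rotated toric codes `[[d²+1, 2, d]]`**: for every loss rate `0 ≤ y < 1/2` there are `C` and
`r < 1` with `P_y[loss pattern of LP[1 + x^{2t+1}, 1 + x] over ℤ_{2t²+2t+1} uncorrectable] ≤ C r^t` for all `t`
(`|G_t| = 2t² + 2t + 1 ≤ 3(t+1)²`, `sys₁ = 2t + 1 ≥ t + 1`). [cite: KestenCMP1980, Thm. 2 (1.7)] [cite: StaceBarrettDoherty2009, p. 2–3]
[cite: KovalevPryadko2013Hyperbicycle, §III.B Ex. 2] -/
theorem rotatedToric_loss_decaysExponentially {y : ℝ} (hy0 : 0 ≤ y) (hy : y < 1 / 2) :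
    DecaysExponentially (fun t y => ErasureDecoder.uncorrectableProb
      {z : ZMod (2 * t ^ 2 + 2 * t + 1) ⊕ ZMod (2 * t ^ 2 + 2 * t + 1) → ZMod 2 |
        (code (((2 * t + 1 : ℕ) : ℤ) : ZMod (2 * t ^ 2 + 2 * t + 1)) 1).HX *ᵥ z = 0}
      ((code (((2 * t + 1 : ℕ) : ℤ) : ZMod (2 * t ^ 2 + 2 * t + 1)) 1).rowSpZ :
        Set (ZMod (2 * t ^ 2 + 2 * t + 1) ⊕ ZMod (2 * t ^ 2 + 2 * t + 1) → ZMod 2)) y) y := by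
  refine twistedToric_loss_decaysExponentially_of_linear (Gs := fun t => ZMod (2 * t ^ 2 + 2 * t + 1))
    (fun t => (((2 * t + 1 : ℕ) : ℤ) : ZMod (2 * t ^ 2 + 2 * t + 1))) (fun t => 1) (A := 3) (m := 2)
    (fun t => ?_) (fun t => ?_) hy0 hy
  · rw [ZMod.card]; push_cast; nlinarith
  · rw [rotated_systole]; omega

open Classical in
/-- **Exponential decay for the dilated family at fixed twist `t`** (`[[2n²c_t, 2, n(2t+1)]]`, index `n`, group
`ℤ_{n+1} × ℤ_{(n+1)c_t}`): for `0 ≤ y < 1/2`, `P_y[uncorrectable] ≤ C r^n` with `r < 1`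
(`|G| = c_t (n+1)²`, `sys₁ = (n+1)(2t+1) ≥ n + 1`).
[cite: KestenCMP1980, Thm. 2 (1.7)] [cite: KovalevPryadko2013Hyperbicycle, §IV Ex. 7] [cite: StaceBarrettDoherty2009, p. 2–3] -/
theorem dilatedToric_loss_decaysExponentially (t : ℕ) {y : ℝ} (hy0 : 0 ≤ y) (hy : y < 1 / 2) :
    DecaysExponentially (fun n y => ErasureDecoder.uncorrectableProb
      {z : (ZMod (n + 1) × ZMod ((n + 1) * (2 * t ^ 2 + 2 * t + 1))) ⊕
          (ZMod (n + 1) × ZMod ((n + 1) * (2 * t ^ 2 + 2 * t + 1))) → ZMod 2 |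
        (code ((1 : ZMod (n + 1)), ((((2 * t + 1 : ℕ) : ℤ)) : ZMod ((n + 1) * (2 * t ^ 2 + 2 * t + 1))))
          ((0 : ZMod (n + 1)), (1 : ZMod ((n + 1) * (2 * t ^ 2 + 2 * t + 1))))).HX *ᵥ z = 0}
      ((code ((1 : ZMod (n + 1)), ((((2 * t + 1 : ℕ) : ℤ)) : ZMod ((n + 1) * (2 * t ^ 2 + 2 * t + 1))))
          ((0 : ZMod (n + 1)), (1 : ZMod ((n + 1) * (2 * t ^ 2 + 2 * t + 1))))).rowSpZ :
        Set ((ZMod (n + 1) × ZMod ((n + 1) * (2 * t ^ 2 + 2 * t + 1))) ⊕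
          (ZMod (n + 1) × ZMod ((n + 1) * (2 * t ^ 2 + 2 * t + 1))) → ZMod 2)) y) y := by
  refine twistedToric_loss_decaysExponentially_of_linear
    (Gs := fun n => ZMod (n + 1) × ZMod ((n + 1) * (2 * t ^ 2 + 2 * t + 1)))
    (fun n => ((1 : ZMod (n + 1)), ((((2 * t + 1 : ℕ) : ℤ)) : ZMod ((n + 1) * (2 * t ^ 2 + 2 * t + 1)))))
    (fun n => ((0 : ZMod (n + 1)), (1 : ZMod ((n + 1) * (2 * t ^ 2 + 2 * t + 1)))))
    (A := ((2 * t ^ 2 + 2 * t + 1 : ℕ) : ℝ)) (m := 2) (fun n => ?_) (fun n => ?_) hy0 hy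
  · rw [Fintype.card_prod, ZMod.card, ZMod.card]; push_cast; nlinarith
  · rw [dilated_systole]
    exact Nat.le_mul_of_pos_right (n + 1) (by omega)

end TwistedToric

end Literature.InformationTheory.QuantumCodes
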